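import Summits.BirchSwinnertonDyer.BirchSwinnertonDyer.Theorems.KolyvaginRoadThreeMethod2TriangulationOfKolyvaginLocal
import Summits.BirchSwinnertonDyer.BirchSwinnertonDyer.Theorems.KolyvaginRoadThreeMethod2KolyvaginTransverseIsotropy
import Summits.BirchSwinnertonDyer.BirchSwinnertonDyer.Theorems.KolyvaginRoadThreeMethod2KolyvaginLine
import Summits.BirchSwinnertonDyer.BirchSwinnertonDyer.Theorems.KolyvaginRoadThreeMethod2KolyvaginPerf
import HarnessLib

/-!
# KOLY method line, crux stmt-BirchSwinnertonDyer-19574 `ZhangSharpFrameAtThreeHL`, stub S2-ENGINE: ZHANG'S LEMMA 8.4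
# TRIANGULATION AT ONE GOOD LEVEL FROM (Supply) ALONE — the Kolyvagin-prime local package DISCHARGED
# (cell `bsd-stepL`, seat `bsd-stepL-zhang3-p1` g9; `--supports 19574`, helper)

`Method2.triangulation_of_kolyvaginLocal` (p508963) reduced the (A3)-triangulation of the S2-ENGINE at one good non-empty
level to the Kolyvagin-prime local package {(Tr-iso), (Perf), (Line)} + (Supply). The three local binders are now tree
theorems, per Kolyvagin prime and per place above it:

* (Tr-iso) `KolyLocal.cupProduct_eq_zero_of_mem_transverseLocalKer` (p511346);
* (Line) `KolyLocal.exists_kummerEigenLine` (p513538);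
* (Perf) `KolyLocal.cupProduct_ne_zero_of_selmer_of_transverse` (`…KolyvaginPerf`).

This file plugs them in: `triangulation_of_supply` — the triangulation at a good non-empty level carrying a non-zero
class, from the frame facts (`K` imaginary quadratic, `E` multiplicative at `3`, `ρ̄_{E,3}` onto, `c ≠ 1`), a level
Kolyvagin system `S`, ANY choice of places `plK`, `plU` above the Kolyvagin ∕ unipotent-admissible primes, and (Supply) at
that level ONLY. [cite: WZhang2014, Lemma 8.4 (1)+(3), §8.1] [cite: GrossLMS1991, Prop. 8.1–8.2, 9.6]
-/

noncomputable section

open scoped Classical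

namespace Summit.BirchSwinnertonDyer.Rank1Residual.X11b.Three.Koly.Method2

open CategoryTheory WeierstrassCurve NumberField IsDedekindDomain Field
  Literature.NumberTheory.EllipticCurves Literature.NumberTheory.EllipticCurves.ModularForms
  Literature.NumberTheory.GaloisRepresentations Module
open Literature.NumberTheory.GaloisRepresentations.DiscreteGaloisModule (mu MuCarrier)
open Literature.NumberTheory.GaloisCohomology
open scoped ContRepresentation

attribute [local instance] absoluteGaloisGroup_compactSpace
attribute [local instance] finite_geomTorsion_of_neZero

variable (W : WeierstrassCurve ℚ) (K : Type) [Field K] [NumberField K]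
variable [W.IsElliptic] [W.IsGloballyMinimal] [NeZero (W.conductorNorm ℤ)]
  (Dt : ModularParametrizationData W (W.conductorNorm ℤ)) (β : ℤ) (ι : K →+* ℂ) (c : K ≃ₐ[ℚ] K)
  [Module (ZMod 3) (V3 W K)]

/-- **Zhang's Lemma 8.4 triangulation at ONE good non-empty level, from (Supply) alone.** Binders: frame facts `hK`,
`hmult`, `hsurj`, `hc`; the level system `S`; places `plK` ∕ `plU` above the Kolyvagin ∕ unipotent-admissible primes
(`hplK`, `hplU`); the level `n` (good, non-empty, carrying a non-zero class `hne`); (Supply) `hSupply` for the level-`n`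
structure. The Kolyvagin-prime local package of `triangulation_of_kolyvaginLocal` is supplied by the tree theorems (Tr-iso)
`KolyLocal.cupProduct_eq_zero_of_mem_transverseLocalKer`, (Perf) `KolyLocal.cupProduct_ne_zero_of_selmer_of_transverse`,
(Line) `KolyLocal.exists_kummerEigenLine`. [cite: WZhang2014, Lemma 8.4 (1)+(3), §8.1] [cite: GrossLMS1991, Prop. 8.1, 8.2, 9.6] -/
theorem triangulation_of_supply (hK : IsImaginaryQuadratic K)
    (hmult : W.HasMultiplicativeReductionAtPrime 3) (hsurj : W.HasSurjectiveModNGaloisRep 3) (hc : c ≠ 1)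
    (S : LevelKolyvaginSystem W K Dt β ι c)
    (plK : {ℓ // Zhang2014.IsKolyvaginPrime (W.conductorNorm ℤ) W K 3 ℓ} → HeightOneSpectrum (𝓞 K))
    (plU : {q // IsUAdmissiblePrime W K q} → HeightOneSpectrum (𝓞 K))
    (hplK : ∀ ℓ, ((ℓ : ℕ) : 𝓞 K) ∈ (plK ℓ).asIdeal) (hplU : ∀ q, ((q : ℕ) : 𝓞 K) ∈ (plU q).asIdeal)
    (n : Finset {q // IsUAdmissiblePrime W K q}) (hg : GoodLevel W K n) (hn : n.Nonempty)
    (hne : ∃ m, S.κ m n ≠ 0)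
    (hSupply : ∀ (ℓ : {ℓ // Zhang2014.IsKolyvaginPrime (W.conductorNorm ℤ) W K 3 ℓ}) (T : Finset _), ℓ ∉ T →
      ∀ s : Bool, ∃ x : V3 W K, conjAct W c ((3 ^ 1 : ℕ) : ℤ) x = sgn s • x ∧ x ≠ 0 ∧
        (∀ w : InfinitePlace K, x ∈ selmerLocalKer (W.baseChange K) w.Completion ((3 ^ 1 : ℕ) : ℤ)) ∧
        (∀ v : HeightOneSpectrum (𝓞 K), v ≠ plK ℓ → (∀ ℓ' ∈ T, plK ℓ' ≠ v) →
          ((∀ q ∈ n, ((q : ℕ) : 𝓞 K) ∉ v.asIdeal) →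
            x ∈ selmerLocalKer (W.baseChange K) (v.adicCompletion K) ((3 ^ 1 : ℕ) : ℤ)) ∧
          (∀ q ∈ n, ((q : ℕ) : 𝓞 K) ∈ v.asIdeal →
            x ∈ (W.baseChange K).ordinaryLocalKer (v.adicCompletion K) ((3 ^ 1 : ℕ) : ℤ))) ∧
        (∀ ℓ' ∈ T, x ∈ transverseLocalKer W K ι ℓ' (plK ℓ'))) :
    ∃ (s : Bool) (d : ℕ), finrank (ZMod 3) (SelQ W K c n s) = d + 1 ∧
      SelQ W K c n s = SelRelQ W K c n (baseLocusQ W K S.κ n) s ∧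
      FiniteDimensional (ZMod 3) (SelRelQ W K c n (baseLocusQ W K S.κ n) (!s)) ∧
      finrank (ZMod 3) (SelRelQ W K c n (baseLocusQ W K S.κ n) (!s)) ≤ d :=
  triangulation_of_kolyvaginLocal W K Dt β ι c hK hmult hsurj hc S plK plU hplK hplU
    (fun e hμ hadd₁ hadd₂ hgal ℓ _ _ hx hy ↦
      KolyLocal.cupProduct_eq_zero_of_mem_transverseLocalKer W K hK ι e hμ hadd₁ hadd₂ hgal ℓ.2 (plK ℓ) (hplK ℓ) hx hy)
    (fun e hμ hadd₁ hadd₂ halt hnondeg hgal ℓ s _ _ hxs hys hxK hx0 hyT hy0 ↦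
      KolyLocal.cupProduct_ne_zero_of_selmer_of_transverse W K hK hsurj ι hc e hμ hadd₁ hadd₂ halt hnondeg hgal ℓ.2
        (plK ℓ) (hplK ℓ) s hxs hys hxK hx0 hyT hy0)
    (fun ℓ s ↦ KolyLocal.exists_kummerEigenLine W K hK hsurj hc ℓ.2 (plK ℓ) (hplK ℓ) s)
    n hg hn hne hSupply

end Summit.BirchSwinnertonDyer.Rank1Residual.X11b.Three.Koly.Method2

end
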